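import Mathlib
import Literature.NumberTheory.LFunctions.Zhang2022.Section7ResidueExtraction
import Literature.NumberTheory.LFunctions.Zhang2022.Section7Rearrangements
import Literature.NumberTheory.LFunctions.Zhang2022.Section7Eq719
import Literature.NumberTheory.LFunctions.Zhang2022.Section7KappaEuler
import Literature.NumberTheory.Sieve.CoprimeSquarefreeSums
import Literature.NumberTheory.LFunctions.MertensElementary
import HarnessLib

/-!
# Zhang (2022) §7, proof of Proposition 7.1 (c): the `(7.18)`-average of the `d₁`-dependent
# contour weight is polylogarithmic (the "harmless" clause of gap row G-d24-1), kernel-checked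

Topic `Literature/NumberTheory/LFunctions/Zhang2022` (Landau–Siegel audit tree; verdict-neutral).
D-0069 campaign, cell `siegel-zhang`, DISCHARGE lane (seat `sz-d25`, block F3). Y. Zhang, *Discrete
mean estimates and the Landau–Siegel zero*, arXiv:2211.02515v1 (2022) [Zhang2022LandauSiegel] — **an
unrefereed manuscript under adjudication**; this file proves an elementary mean-value bound and
asserts nothing about the manuscript's Theorems 1–2 or about Landau–Siegel zeros.

Context (§7 pp. 40–41, tex L2104–L2138). The residue formula `Z22:§7.u049` and its summed form
`Z22:§7.u052` print their errors `O(pkε₁/l₂)`, `O(Pkε₁)` with constants uniform in `d₁, d₂, k`; the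
campaign's row G-d24-1 records that the manuscript's own inputs (the "simple bounds"
`|κ̃(d₁;m,s)| ≤ τ₅(d₁)∏_{q∣d₁}(1 + cq^{−σ})`, `|λ(m,s)| ≤ ∏_{q∣m}(1 + cq^{−σ})`, tex L2085–2090) only
give these errors with the WEIGHT
`G₀(d₁,d₂,k) = τ₅(d₁)·∏_{q∣d₁d₂k}(1 + 200q^{−9/10})²`
(seat sz-d24's contour bound), and that this is harmless for (7.20) because the weights of (7.18) are
`1/(d₁d₂kφ(k))`. The kernel edge `Section7dStatements.eq720_of_weighted`
(`Section7ResidueExtraction`) turns "harmless" into the hypothesis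
`Σ_{d₁,d₂,k<⌈PT⁻²⌉} G₀(d₁,d₂,k)/(d₁d₂φ(k)) ≤ C₀𝓛^K` for large `D`; **this file PROVES that hypothesis**
for `G₀` exactly as above (`weightSum_tauFive_le`), with `K = 9·646416` (any power of `𝓛 = log D`
is absorbed by `ε₁ = exp{−c𝓛^{1/10}}`, so the size of `K` is immaterial).

| decl | content |
|---|---|
| `weightSum_tauFive_le` | `∃ K C₀ D₁, ∀ D ≥ D₁, Σ_{d₁,d₂,k<⌈PT⁻²⌉} τ₅(d₁)∏_{q∣d₁d₂k}(1+200/q^{9/10})²/(d₁d₂φ(k)) ≤ C₀𝓛^K` |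
| `eq720_of_step7u047_of_weighted_contour_bound` | `Step7u047 c′ →` (the `G₀`-weighted contour bound, seat sz-d24's target) `→ Eq720 c′`: (7.20) AS PRINTED from the contour identity `Z22:§7.u047` and the repaired "standard estimates", via `eq719_holds`, `step7u045_holds`, `eq718_holds` and the weighted edges of `Section7ResidueExtraction` |

Route (elementary, no facts): `∏_{q∣abc} g ≤ ∏_{q∣a}g·∏_{q∣b}g·∏_{q∣c}g` for `g ≥ 1`;
`φ(k) = k∏_{q∣k}(1 − q⁻¹)`; `Σ_{n≤X} τ₅(n)b(n) ≤ (Σ_{n≤X} b(n))⁵` for sub-multiplicative `b ≥ 0`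
(`τ₅ = ζ⁵`, hyperbola rearrangement); `Σ_{n≤X} (∏_{q∣n} g q)/n ≤ ∏_{p≤X}(1 + 2Γ/p) ≤
exp(2Γ(log log X + 4))` (the tree's `SquarefreeSums.sum_le_prod_sum_prime_pow` and Mertens bound
`MertensBound.sum_inv_prime_le`); `log⌈PT⁻²⌉ ≤ 1 + 𝓛⁹`.

## References

* Y. Zhang, arXiv:2211.02515v1 (2022), §7 pp. 40–41, (7.18)–(7.20) and the "simple bounds" before
  (7.19). [cite: Zhang2022LandauSiegel, §7 pp.40–41, tex L2085–L2138]
-/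

noncomputable section

open Real Finset

namespace Literature.NumberTheory.LFunctions.Zhang2022.Section7dStatements

/-! ## Prime-support weights -/

/-- A prime-support weight `∏_{q∣n} g(q)` with `g ≥ 1` is sub-multiplicative:
`∏_{q∣ab} g ≤ ∏_{q∣a} g · ∏_{q∣b} g`. [folklore] -/
private theorem prod_primeFactors_mul_le (g : ℕ → ℝ) (hg : ∀ p, p.Prime → 1 ≤ g p) {a b : ℕ}
    (ha : a ≠ 0) (hb : b ≠ 0) :
    ∏ q ∈ (a * b).primeFactors, g q ≤ (∏ q ∈ a.primeFactors, g q) * ∏ q ∈ b.primeFactors, g q := by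
  rw [Nat.primeFactors_mul ha hb]
  have h1 : ∀ q ∈ a.primeFactors ∪ b.primeFactors, (1 : ℝ) ≤ g q := fun q hq => by
    rcases Finset.mem_union.mp hq with h | h
    · exact hg q (Nat.prime_of_mem_primeFactors h)
    · exact hg q (Nat.prime_of_mem_primeFactors h)
  have key := Finset.prod_union_inter (s₁ := a.primeFactors) (s₂ := b.primeFactors) (f := g)
  have hinter : (1 : ℝ) ≤ ∏ q ∈ a.primeFactors ∩ b.primeFactors, g q := by
    calc (1 : ℝ) = ∏ _q ∈ a.primeFactors ∩ b.primeFactors, (1 : ℝ) := Finset.prod_const_one.symm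
      _ ≤ _ := Finset.prod_le_prod (fun _ _ => zero_le_one) fun q hq =>
          hg q (Nat.prime_of_mem_primeFactors (Finset.mem_inter.mp hq).1)
  have hunion : 0 ≤ ∏ q ∈ a.primeFactors ∪ b.primeFactors, g q :=
    Finset.prod_nonneg fun q hq => zero_le_one.trans (h1 q hq)
  calc ∏ q ∈ a.primeFactors ∪ b.primeFactors, g q
      = (∏ q ∈ a.primeFactors ∪ b.primeFactors, g q) * 1 := (mul_one _).symm
    _ ≤ (∏ q ∈ a.primeFactors ∪ b.primeFactors, g q) *
          ∏ q ∈ a.primeFactors ∩ b.primeFactors, g q := mul_le_mul_of_nonneg_left hinter hunion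
    _ = (∏ q ∈ a.primeFactors, g q) * ∏ q ∈ b.primeFactors, g q := key

/-- The prime-support weight is `≥ 1` (in particular positive). [folklore] -/
private theorem one_le_prod_primeFactors (g : ℕ → ℝ) (hg : ∀ p, p.Prime → 1 ≤ g p) (n : ℕ) :
    1 ≤ ∏ q ∈ n.primeFactors, g q := by
  calc (1 : ℝ) = ∏ _q ∈ n.primeFactors, (1 : ℝ) := Finset.prod_const_one.symm
    _ ≤ _ := Finset.prod_le_prod (fun _ _ => zero_le_one) fun q hq =>
        hg q (Nat.prime_of_mem_primeFactors hq)

/-! ## `Σ_{n ≤ X} (∏_{q∣n} g q)/n ≤ exp(2Γ(log log X + 4))` -/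

/-- Mean value of a bounded prime-support weight against `1/n`: for `1 ≤ g ≤ Γ` on primes and
`X ≥ 2`, `Σ_{n≤X} (∏_{q∣n} g(q))/n ≤ ∏_{p≤X}(1 + 2Γ/p) ≤ exp(2Γ(log log X + 4))` (multiplicativity
and Mertens). [folklore] -/
private theorem sum_weight_div_le (g : ℕ → ℝ) (Γ : ℝ) (hg : ∀ p, p.Prime → 1 ≤ g p ∧ g p ≤ Γ)
    (X : ℕ) (hX : 2 ≤ X) :
    ∑ n ∈ Finset.Icc 1 X, (∏ q ∈ n.primeFactors, g q) / n ≤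
      Real.exp (2 * Γ * (Real.log (Real.log X) + 4)) := by
  have hΓ : 1 ≤ Γ := (hg 2 Nat.prime_two).1.trans (hg 2 Nat.prime_two).2
  set f : ArithmeticFunction ℝ := (ArithmeticFunction.prodPrimeFactors g).pdiv
    ((ArithmeticFunction.id : ArithmeticFunction ℕ) : ArithmeticFunction ℝ) with hf
  have hfm : f.IsMultiplicative :=
    (ArithmeticFunction.IsMultiplicative.prodPrimeFactors g).pdiv
      ArithmeticFunction.isMultiplicative_id.natCast
  have hfapply : ∀ m : ℕ, m ≠ 0 → f m = (∏ q ∈ m.primeFactors, g q) / m := by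
    intro m hm
    rw [hf, ArithmeticFunction.pdiv_apply, ArithmeticFunction.prodPrimeFactors_apply hm,
      ArithmeticFunction.natCoe_apply, ArithmeticFunction.id_apply]
  have hf0 : ∀ m, 0 ≤ f m := by
    intro m
    rcases eq_or_ne m 0 with rfl | hm
    · simp
    · rw [hfapply m hm]
      exact div_nonneg (zero_le_one.trans (one_le_prod_primeFactors g (fun p hp => (hg p hp).1) m))
        (Nat.cast_nonneg m)
  have h1 : ∑ n ∈ Finset.Icc 1 X, (∏ q ∈ n.primeFactors, g q) / n = ∑ n ∈ Finset.Icc 1 X, f n :=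
    Finset.sum_congr rfl fun n hn => (hfapply n (by have := (Finset.mem_Icc.mp hn).1; omega)).symm
  rw [h1]
  refine (Sieve.SquarefreeSums.sum_le_prod_sum_prime_pow hfm hf0 X).trans ?_
  -- the local factors
  have hloc : ∀ p ∈ Nat.primesBelow (X + 1),
      ∑ j ∈ Finset.range (X + 1), f (p ^ j) ≤ 1 + 2 * Γ / p := by
    intro p hp
    have hpr : p.Prime := (Nat.mem_primesBelow.mp hp).2
    have hp2 : (2 : ℝ) ≤ p := by exact_mod_cast hpr.two_le
    have hp0 : (0 : ℝ) < p := by linarith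
    rw [Finset.sum_range_succ', pow_zero, hfm.map_one]
    have hterm : ∀ i ∈ Finset.range X, f (p ^ (i + 1)) = g p * (1 / (p : ℝ)) * (1 / (p : ℝ)) ^ i := by
      intro i _
      have hne : p ^ (i + 1) ≠ 0 := pow_ne_zero _ hpr.ne_zero
      rw [hfapply _ hne, Nat.primeFactors_prime_pow (Nat.succ_ne_zero i) hpr, Finset.prod_singleton,
        Nat.cast_pow, mul_assoc, ← pow_succ', one_div, inv_pow, div_eq_mul_inv]
    rw [Finset.sum_congr rfl hterm, ← Finset.mul_sum]
    have hgeom : ∑ i ∈ Finset.range X, (1 / (p : ℝ)) ^ i ≤ 2 := by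
      have h := geom_sum_Ico_le_of_lt_one (m := 0) (n := X) (x := 1 / (p : ℝ)) (by positivity)
        (by rw [div_lt_one hp0]; linarith)
      rw [← Finset.range_eq_Ico, pow_zero] at h
      have hden : (1 : ℝ) / 2 ≤ 1 - 1 / (p : ℝ) := by
        have : 1 / (p : ℝ) ≤ 1 / 2 := by
          rw [div_le_div_iff_of_pos_left one_pos hp0 two_pos]
          exact hp2
        linarith
      calc ∑ i ∈ Finset.range X, (1 / (p : ℝ)) ^ i ≤ 1 / (1 - 1 / (p : ℝ)) := h
        _ ≤ 1 / (1 / 2) := by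
            apply one_div_le_one_div_of_le (by norm_num) hden
        _ = 2 := by norm_num
    have hgp := hg p hpr
    have hg0 : 0 ≤ g p := zero_le_one.trans hgp.1
    calc g p * (1 / (p : ℝ)) * ∑ i ∈ Finset.range X, (1 / (p : ℝ)) ^ i + 1
        ≤ Γ * (1 / (p : ℝ)) * 2 + 1 := by
          gcongr
          exact hgp.2
      _ = 1 + 2 * Γ / p := by ring
  have hΓ0 : 0 ≤ Γ := zero_le_one.trans hΓ
  calc ∏ p ∈ Nat.primesBelow (X + 1), ∑ j ∈ Finset.range (X + 1), f (p ^ j)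
      ≤ ∏ p ∈ Nat.primesBelow (X + 1), (1 + 2 * Γ / p) :=
        Finset.prod_le_prod (fun p _ => Finset.sum_nonneg fun j _ => hf0 _) hloc
    _ ≤ Real.exp (∑ p ∈ Nat.primesBelow (X + 1), 2 * Γ / (p : ℝ)) :=
        Sieve.SquarefreeSums.prod_one_add_le_exp_sum fun p _ => by positivity
    _ ≤ Real.exp (2 * Γ * (Real.log (Real.log X) + 4)) := by
        apply Real.exp_le_exp.mpr
        have hM := MertensBound.sum_inv_prime_le X hX
        have heq : ∑ p ∈ Nat.primesBelow (X + 1), 2 * Γ / (p : ℝ) =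
            2 * Γ * ∑ p ∈ Nat.primesLE X, 1 / (p : ℝ) := by
          rw [Finset.mul_sum]
          exact Finset.sum_congr rfl fun p _ => by ring
        rw [heq]
        exact mul_le_mul_of_nonneg_left hM (by positivity)

/-! ## `Σ_{n ≤ X} τ_k(n) b(n) ≤ (Σ_{n ≤ X} b(n))^k` for sub-multiplicative `b` -/

/-- Convolution powers against a sub-multiplicative weight: for `b ≥ 0` with `b(1) ≤ 1` and
`b(de) ≤ b(d)b(e)`, `Σ_{n≤X} ζ^{*k}(n)·b(n) ≤ (Σ_{n≤X} b(n))^k` (`ζ^{*5}(n) = τ₅(n)`); by the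
hyperbola rearrangement `Σ_{n≤X}Σ_{de=n} = Σ_{d≤X}Σ_{e≤X/d}`. [folklore] -/
private theorem sum_zeta_pow_mul_le (b : ℕ → ℝ) (hb0 : ∀ n, 0 ≤ b n) (hb1 : b 1 ≤ 1)
    (hsub : ∀ d e : ℕ, d ≠ 0 → e ≠ 0 → b (d * e) ≤ b d * b e) (X : ℕ) :
    ∀ k : ℕ, ∑ n ∈ Finset.Icc 1 X,
      (((ArithmeticFunction.zeta ^ k : ArithmeticFunction ℕ) n : ℕ) : ℝ) * b n ≤
        (∑ m ∈ Finset.Icc 1 X, b m) ^ k := by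
  intro k
  induction k with
  | zero =>
    rw [pow_zero, pow_zero]
    calc ∑ n ∈ Finset.Icc 1 X, (((1 : ArithmeticFunction ℕ) n : ℕ) : ℝ) * b n
        ≤ ∑ n ∈ Finset.Icc 1 X, (if n = 1 then b n else 0) := by
          refine Finset.sum_le_sum fun n _ => ?_
          rw [ArithmeticFunction.one_apply]
          split_ifs with h
          · simp
          · simp
      _ = if (1 : ℕ) ∈ Finset.Icc 1 X then b 1 else 0 := Finset.sum_ite_eq' _ _ _
      _ ≤ 1 := by
          split_ifs
          · exact hb1
          · exact zero_le_one
  | succ k ih =>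
    have hS0 : 0 ≤ ∑ m ∈ Finset.Icc 1 X, b m := Finset.sum_nonneg fun m _ => hb0 m
    rw [pow_succ]
    calc ∑ n ∈ Finset.Icc 1 X,
          (((ArithmeticFunction.zeta ^ k * ArithmeticFunction.zeta : ArithmeticFunction ℕ) n : ℕ) :
            ℝ) * b n
        = ∑ n ∈ Finset.Icc 1 X, ∑ q ∈ n.divisorsAntidiagonal,
            (((ArithmeticFunction.zeta ^ k : ArithmeticFunction ℕ) q.1 : ℕ) : ℝ) * b (q.1 * q.2) := by
          refine Finset.sum_congr rfl fun n _ => ?_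
          rw [ArithmeticFunction.mul_apply, Nat.cast_sum, Finset.sum_mul]
          refine Finset.sum_congr rfl fun q hq => ?_
          have hq' := Nat.mem_divisorsAntidiagonal.mp hq
          have hq2 : q.2 ≠ 0 := (mul_ne_zero_iff.mp (hq'.1.symm ▸ hq'.2)).2
          rw [ArithmeticFunction.zeta_apply_ne hq2, mul_one, hq'.1]
      _ ≤ ∑ n ∈ Finset.Icc 1 X, ∑ q ∈ n.divisorsAntidiagonal,
            (((ArithmeticFunction.zeta ^ k : ArithmeticFunction ℕ) q.1 : ℕ) : ℝ) * b q.1 * b q.2 := by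
          refine Finset.sum_le_sum fun n _ => Finset.sum_le_sum fun q hq => ?_
          have hq' := Nat.mem_divisorsAntidiagonal.mp hq
          have hq12 := mul_ne_zero_iff.mp (hq'.1.symm ▸ hq'.2)
          rw [mul_assoc]
          exact mul_le_mul_of_nonneg_left (hsub q.1 q.2 hq12.1 hq12.2) (Nat.cast_nonneg _)
      _ = ∑ d ∈ Finset.Icc 1 X, ∑ e ∈ Finset.Icc 1 (X / d),
            (((ArithmeticFunction.zeta ^ k : ArithmeticFunction ℕ) d : ℕ) : ℝ) * b d * b e :=
          Sieve.SquarefreeSums.sum_Icc_sum_divisorsAntidiagonal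
            (fun d e => (((ArithmeticFunction.zeta ^ k : ArithmeticFunction ℕ) d : ℕ) : ℝ) *
              b d * b e) X
      _ ≤ ∑ d ∈ Finset.Icc 1 X, ∑ e ∈ Finset.Icc 1 X,
            (((ArithmeticFunction.zeta ^ k : ArithmeticFunction ℕ) d : ℕ) : ℝ) * b d * b e := by
          refine Finset.sum_le_sum fun d _ => Finset.sum_le_sum_of_subset_of_nonneg
            (Finset.Icc_subset_Icc_right (Nat.div_le_self X d)) fun e _ _ => ?_
          have := hb0 d
          have := hb0 e
          positivity
      _ = (∑ d ∈ Finset.Icc 1 X,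
            (((ArithmeticFunction.zeta ^ k : ArithmeticFunction ℕ) d : ℕ) : ℝ) * b d) *
            ∑ e ∈ Finset.Icc 1 X, b e := by
          rw [Finset.sum_mul_sum]
      _ ≤ (∑ m ∈ Finset.Icc 1 X, b m) ^ k * ∑ e ∈ Finset.Icc 1 X, b e :=
          mul_le_mul_of_nonneg_right ih hS0

/-! ## The weight sum of G-d24-1 -/

/-- `log⌈PT⁻²⌉ ≤ 1 + 𝓛⁹`. [cite: Zhang2022LandauSiegel, §7 (7.2) p.33] -/
private theorem log_nsupp_le' (D : ℕ) : Real.log (Skeleton.Nsupp D) ≤ 1 + Skeleton.ell D ^ 9 := by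
  have hℓ0 : 0 ≤ Skeleton.ell D := Real.log_natCast_nonneg D
  have hP : 0 < Skeleton.bigP D := Real.exp_pos _
  have hT1 : 1 ≤ Skeleton.bigT D ^ 2 :=
    one_le_pow₀ (Real.one_le_exp (Real.rpow_nonneg hℓ0 _))
  have hN : (Skeleton.Nsupp D : ℝ) ≤ 2 * Skeleton.bigP D := by
    have h1 : (Skeleton.Nsupp D : ℝ) < Skeleton.bigP D / Skeleton.bigT D ^ 2 + 1 :=
      Nat.ceil_lt_add_one (by positivity)
    have h2 : Skeleton.bigP D / Skeleton.bigT D ^ 2 ≤ Skeleton.bigP D := div_le_self hP.le hT1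
    have h3 : 1 ≤ Skeleton.bigP D := Real.one_le_exp (by positivity)
    linarith
  rcases Nat.eq_zero_or_pos (Skeleton.Nsupp D) with h0 | hpos
  · rw [h0, Nat.cast_zero, Real.log_zero]
    positivity
  calc Real.log (Skeleton.Nsupp D) ≤ Real.log (2 * Skeleton.bigP D) :=
        Real.log_le_log (by exact_mod_cast hpos) hN
    _ = Real.log 2 + Skeleton.ell D ^ 9 := by
        rw [Real.log_mul (by norm_num) hP.ne', Skeleton.bigP, Real.log_exp]
    _ ≤ 1 + Skeleton.ell D ^ 9 := by linarith [Real.log_two_lt_d9]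

set_option maxHeartbeats 400000 in
/-- **The `(7.18)`-average of the contour weight is polylogarithmic** (the "harmless" clause of
G-d24-1, as the hypothesis of `eq720_of_weighted`): with
`G₀(d₁,d₂,k) = τ₅(d₁)·∏_{q∣d₁d₂k}(1 + 200/q^{9/10})²`,
`Σ_{d₁,d₂,k < ⌈PT⁻²⌉} G₀(d₁,d₂,k)/(d₁d₂φ(k)) ≤ C₀·𝓛^K` for `D ≥ 3` (`K = 9·646416`, `C₀ = e^{4·646416}2^{646416}`). Proof:
`∏_{q∣d₁d₂k} ≤ ∏_{q∣d₁}∏_{q∣d₂}∏_{q∣k}`, `φ(k) = k∏_{q∣k}(1−q⁻¹)`, `Σ τ₅b ≤ (Σ b)⁵`, the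
multiplicative mean value against `1/n`, Mertens, and `log⌈PT⁻²⌉ ≤ 1 + 𝓛⁹`.
[cite: Zhang2022LandauSiegel, §7 pp.40–41, tex L2085–L2138] -/
theorem weightSum_tauFive_le : ∃ K : ℕ, ∃ C₀ : ℝ, ∃ D₁ : ℕ, ∀ D : ℕ, D₁ ≤ D →
    ∑ d₁ ∈ Finset.Ico 1 (Skeleton.Nsupp D), ∑ d₂ ∈ Finset.Ico 1 (Skeleton.Nsupp D),
      ∑ k ∈ Finset.Ico 1 (Skeleton.Nsupp D),
        ((tauFive d₁ : ℝ) * ∏ q ∈ (d₁ * d₂ * k).primeFactors, (1 + 200 / (q : ℝ) ^ (9 / 10 : ℝ)) ^ 2) /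
          ((d₁ : ℝ) * d₂ * (Nat.totient k : ℝ)) ≤ C₀ * Skeleton.ell D ^ K := by
  -- the two prime weights and their bounds
  set g₁ : ℕ → ℝ := fun q => (1 + 200 / (q : ℝ) ^ (9 / 10 : ℝ)) ^ 2 with hg₁
  set g₃ : ℕ → ℝ := fun q => (1 + 200 / (q : ℝ) ^ (9 / 10 : ℝ)) ^ 2 * ((q : ℝ) / ((q : ℝ) - 1))
    with hg₃
  have hg₁b : ∀ p, p.Prime → 1 ≤ g₁ p ∧ g₁ p ≤ 40401 := by
    intro p hp
    have hp1 : (1 : ℝ) ≤ p := by exact_mod_cast hp.one_lt.le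
    have hq : 1 ≤ (p : ℝ) ^ (9 / 10 : ℝ) := Real.one_le_rpow hp1 (by norm_num)
    have h0 : 0 ≤ 200 / (p : ℝ) ^ (9 / 10 : ℝ) := by positivity
    have h200 : 200 / (p : ℝ) ^ (9 / 10 : ℝ) ≤ 200 := div_le_self (by norm_num) hq
    refine ⟨?_, ?_⟩
    · rw [hg₁]
      nlinarith
    · rw [hg₁]
      nlinarith
  have hg₃b : ∀ p, p.Prime → 1 ≤ g₃ p ∧ g₃ p ≤ 80802 := by
    intro p hp
    have hp2 : (2 : ℝ) ≤ p := by exact_mod_cast hp.two_le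
    have h1 := hg₁b p hp
    have hr1 : 1 ≤ (p : ℝ) / ((p : ℝ) - 1) := by
      rw [le_div_iff₀ (by linarith)]
      linarith
    have hr2 : (p : ℝ) / ((p : ℝ) - 1) ≤ 2 := by
      rw [div_le_iff₀ (by linarith)]
      linarith
    have hg₁0 : 0 ≤ g₁ p := zero_le_one.trans h1.1
    refine ⟨?_, ?_⟩
    · rw [hg₃]
      change 1 ≤ g₁ p * ((p : ℝ) / ((p : ℝ) - 1))
      nlinarith
    · rw [hg₃]
      change g₁ p * ((p : ℝ) / ((p : ℝ) - 1)) ≤ 80802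
      nlinarith
  have hg₁1 : ∀ p, p.Prime → 1 ≤ g₁ p := fun p hp => (hg₁b p hp).1
  have hg₃1 : ∀ p, p.Prime → 1 ≤ g₃ p := fun p hp => (hg₃b p hp).1
  -- the three one-variable weights
  set b : ℕ → ℝ := fun n => (∏ q ∈ n.primeFactors, g₁ q) / n with hb
  set c : ℕ → ℝ := fun n => (∏ q ∈ n.primeFactors, g₃ q) / n with hc
  have hb0 : ∀ n, 0 ≤ b n := fun n =>
    div_nonneg (zero_le_one.trans (one_le_prod_primeFactors g₁ hg₁1 n)) (Nat.cast_nonneg n)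
  have hc0 : ∀ n, 0 ≤ c n := fun n =>
    div_nonneg (zero_le_one.trans (one_le_prod_primeFactors g₃ hg₃1 n)) (Nat.cast_nonneg n)
  have hb1 : b 1 ≤ 1 := by simp [hb]
  have hbsub : ∀ d e : ℕ, d ≠ 0 → e ≠ 0 → b (d * e) ≤ b d * b e := by
    intro d e hd he
    simp only [hb]
    have hd0 : (0 : ℝ) < d := by exact_mod_cast Nat.pos_of_ne_zero hd
    have he0 : (0 : ℝ) < e := by exact_mod_cast Nat.pos_of_ne_zero he
    rw [div_mul_div_comm, Nat.cast_mul]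
    exact div_le_div_of_nonneg_right (prod_primeFactors_mul_le g₁ hg₁1 hd he) (by positivity)
  obtain ⟨cK, hcK⟩ : ∃ cK : ℕ, cK = 646416 := ⟨_, rfl⟩
  refine ⟨9 * cK, Real.exp ((cK : ℝ) * 4) * 2 ^ cK, 3, fun D hD => ?_⟩
  set N := Skeleton.Nsupp D with hN
  set X := max (N - 1) 2 with hX
  have hX2 : 2 ≤ X := le_max_right _ _
  have hsub : Finset.Ico 1 N ⊆ Finset.Icc 1 X := by
    intro n hn
    rw [Finset.mem_Ico] at hn
    rw [Finset.mem_Icc]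
    exact ⟨hn.1, le_trans (by omega) (le_max_left _ _)⟩
  -- (1) the termwise bound
  have hterm : ∀ d₁ ∈ Finset.Ico 1 N, ∀ d₂ ∈ Finset.Ico 1 N, ∀ k ∈ Finset.Ico 1 N,
      ((tauFive d₁ : ℝ) * ∏ q ∈ (d₁ * d₂ * k).primeFactors, (1 + 200 / (q : ℝ) ^ (9 / 10 : ℝ)) ^ 2) /
          ((d₁ : ℝ) * d₂ * (Nat.totient k : ℝ)) ≤
        ((tauFive d₁ : ℝ) * b d₁) * b d₂ * c k := by
    intro d₁ hd₁ d₂ hd₂ k hk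
    have hd₁0 : d₁ ≠ 0 := by have := (Finset.mem_Ico.mp hd₁).1; omega
    have hd₂0 : d₂ ≠ 0 := by have := (Finset.mem_Ico.mp hd₂).1; omega
    have hk0 : k ≠ 0 := by have := (Finset.mem_Ico.mp hk).1; omega
    have hd₁R : (0 : ℝ) < d₁ := by exact_mod_cast Nat.pos_of_ne_zero hd₁0
    have hd₂R : (0 : ℝ) < d₂ := by exact_mod_cast Nat.pos_of_ne_zero hd₂0
    have hkR : (0 : ℝ) < k := by exact_mod_cast Nat.pos_of_ne_zero hk0
    have hφ : (0 : ℝ) < Nat.totient k := by exact_mod_cast Nat.totient_pos.mpr (Nat.pos_of_ne_zero hk0)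
    -- split the weight
    have hw : ∏ q ∈ (d₁ * d₂ * k).primeFactors, (1 + 200 / (q : ℝ) ^ (9 / 10 : ℝ)) ^ 2 ≤
        (∏ q ∈ d₁.primeFactors, g₁ q) * (∏ q ∈ d₂.primeFactors, g₁ q) *
          ∏ q ∈ k.primeFactors, g₁ q := by
      calc ∏ q ∈ (d₁ * d₂ * k).primeFactors, (1 + 200 / (q : ℝ) ^ (9 / 10 : ℝ)) ^ 2
          ≤ (∏ q ∈ (d₁ * d₂).primeFactors, g₁ q) * ∏ q ∈ k.primeFactors, g₁ q :=
            prod_primeFactors_mul_le g₁ hg₁1 (mul_ne_zero hd₁0 hd₂0) hk0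
        _ ≤ ((∏ q ∈ d₁.primeFactors, g₁ q) * ∏ q ∈ d₂.primeFactors, g₁ q) *
              ∏ q ∈ k.primeFactors, g₁ q :=
            mul_le_mul_of_nonneg_right (prod_primeFactors_mul_le g₁ hg₁1 hd₁0 hd₂0)
              (zero_le_one.trans (one_le_prod_primeFactors g₁ hg₁1 k))
    -- `(∏_{q∣k} g₁ q)/φ(k) = c k`
    have hφeq : (∏ q ∈ k.primeFactors, g₁ q) / (Nat.totient k : ℝ) = c k := by
      simp only [hc, hg₃, hg₁]
      rw [MertensBound.totient_eq_mul_prod_one_sub_inv k, Finset.prod_mul_distrib]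
      have hprod : ∏ q ∈ k.primeFactors, ((q : ℝ) / ((q : ℝ) - 1)) =
          (∏ q ∈ k.primeFactors, (1 - 1 / (q : ℝ)))⁻¹ := by
        rw [← Finset.prod_inv_distrib]
        refine Finset.prod_congr rfl fun q hq => ?_
        have hq2 : (2 : ℝ) ≤ q := by exact_mod_cast (Nat.prime_of_mem_primeFactors hq).two_le
        field_simp
      rw [hprod]
      have hP0 : (∏ q ∈ k.primeFactors, (1 - 1 / (q : ℝ))) ≠ 0 := by
        refine Finset.prod_ne_zero_iff.mpr fun q hq => ?_
        have hq2 : (2 : ℝ) ≤ q := by exact_mod_cast (Nat.prime_of_mem_primeFactors hq).two_le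
        have : 1 / (q : ℝ) ≤ 1 / 2 := by
          rw [div_le_div_iff_of_pos_left one_pos (by linarith) two_pos]; exact hq2
        linarith
      field_simp
    have htau : 0 ≤ (tauFive d₁ : ℝ) := Nat.cast_nonneg _
    calc ((tauFive d₁ : ℝ) * ∏ q ∈ (d₁ * d₂ * k).primeFactors, (1 + 200 / (q : ℝ) ^ (9 / 10 : ℝ)) ^ 2) /
          ((d₁ : ℝ) * d₂ * (Nat.totient k : ℝ))
        ≤ ((tauFive d₁ : ℝ) * ((∏ q ∈ d₁.primeFactors, g₁ q) * (∏ q ∈ d₂.primeFactors, g₁ q) *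
            ∏ q ∈ k.primeFactors, g₁ q)) / ((d₁ : ℝ) * d₂ * (Nat.totient k : ℝ)) := by
          gcongr
      _ = ((tauFive d₁ : ℝ) * b d₁) * b d₂ *
            ((∏ q ∈ k.primeFactors, g₁ q) / (Nat.totient k : ℝ)) := by
          simp only [hb]
          field_simp
      _ = ((tauFive d₁ : ℝ) * b d₁) * b d₂ * c k := by rw [hφeq]
  -- (2) sum the termwise bound and factor
  have hS0b : 0 ≤ ∑ m ∈ Finset.Icc 1 X, b m := Finset.sum_nonneg fun m _ => hb0 m
  have hS0c : 0 ≤ ∑ m ∈ Finset.Icc 1 X, c m := Finset.sum_nonneg fun m _ => hc0 m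
  have hstep : ∑ d₁ ∈ Finset.Ico 1 N, ∑ d₂ ∈ Finset.Ico 1 N, ∑ k ∈ Finset.Ico 1 N,
      ((tauFive d₁ : ℝ) * ∏ q ∈ (d₁ * d₂ * k).primeFactors, (1 + 200 / (q : ℝ) ^ (9 / 10 : ℝ)) ^ 2) /
          ((d₁ : ℝ) * d₂ * (Nat.totient k : ℝ)) ≤
      (∑ d₁ ∈ Finset.Icc 1 X, (tauFive d₁ : ℝ) * b d₁) * (∑ d₂ ∈ Finset.Icc 1 X, b d₂) *
        ∑ k ∈ Finset.Icc 1 X, c k := by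
    calc ∑ d₁ ∈ Finset.Ico 1 N, ∑ d₂ ∈ Finset.Ico 1 N, ∑ k ∈ Finset.Ico 1 N,
          ((tauFive d₁ : ℝ) * ∏ q ∈ (d₁ * d₂ * k).primeFactors,
              (1 + 200 / (q : ℝ) ^ (9 / 10 : ℝ)) ^ 2) / ((d₁ : ℝ) * d₂ * (Nat.totient k : ℝ))
        ≤ ∑ d₁ ∈ Finset.Ico 1 N, ∑ d₂ ∈ Finset.Ico 1 N, ∑ k ∈ Finset.Ico 1 N,
            ((tauFive d₁ : ℝ) * b d₁) * b d₂ * c k :=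
          Finset.sum_le_sum fun d₁ hd₁ => Finset.sum_le_sum fun d₂ hd₂ =>
            Finset.sum_le_sum fun k hk => hterm d₁ hd₁ d₂ hd₂ k hk
      _ ≤ ∑ d₁ ∈ Finset.Icc 1 X, ∑ d₂ ∈ Finset.Icc 1 X, ∑ k ∈ Finset.Icc 1 X,
            ((tauFive d₁ : ℝ) * b d₁) * b d₂ * c k := by
          refine (Finset.sum_le_sum_of_subset_of_nonneg hsub fun d₁ _ _ => ?_).trans
            (Finset.sum_le_sum fun d₁ _ => ?_)
          · exact Finset.sum_nonneg fun d₂ _ => Finset.sum_nonneg fun k _ => by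
              have := hb0 d₁; have := hb0 d₂; have := hc0 k; positivity
          refine (Finset.sum_le_sum_of_subset_of_nonneg hsub fun d₂ _ _ => ?_).trans
            (Finset.sum_le_sum fun d₂ _ => ?_)
          · exact Finset.sum_nonneg fun k _ => by
              have := hb0 d₁; have := hb0 d₂; have := hc0 k; positivity
          exact Finset.sum_le_sum_of_subset_of_nonneg hsub fun k _ _ => by
            have := hb0 d₁; have := hb0 d₂; have := hc0 k; positivity
      _ = (∑ d₁ ∈ Finset.Icc 1 X, (tauFive d₁ : ℝ) * b d₁) * (∑ d₂ ∈ Finset.Icc 1 X, b d₂) *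
            ∑ k ∈ Finset.Icc 1 X, c k := by
          rw [Finset.sum_mul_sum, Finset.sum_mul_sum]
          refine Finset.sum_congr rfl fun d₁ _ => ?_
          rw [Finset.sum_comm]
          simp only [Finset.sum_mul]
  -- (3) the three one-variable sums
  have hA : ∑ d₁ ∈ Finset.Icc 1 X, (tauFive d₁ : ℝ) * b d₁ ≤ (∑ m ∈ Finset.Icc 1 X, b m) ^ 5 :=
    sum_zeta_pow_mul_le b hb0 hb1 hbsub X 5
  have hB : ∑ m ∈ Finset.Icc 1 X, b m ≤ Real.exp (2 * 40401 * (Real.log (Real.log X) + 4)) :=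
    sum_weight_div_le g₁ 40401 hg₁b X hX2
  have hC : ∑ m ∈ Finset.Icc 1 X, c m ≤ Real.exp (2 * 80802 * (Real.log (Real.log X) + 4)) :=
    sum_weight_div_le g₃ 80802 hg₃b X hX2
  -- (4) combine: everything ≤ exp(646416 (log log X + 4)) = e^{4·646416} (log X)^646416
  have hXR : (2 : ℝ) ≤ X := by exact_mod_cast hX2
  have hlogX : 0 < Real.log X := Real.log_pos (by linarith)
  have hE : (∑ d₁ ∈ Finset.Icc 1 X, (tauFive d₁ : ℝ) * b d₁) * (∑ d₂ ∈ Finset.Icc 1 X, b d₂) *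
      ∑ k ∈ Finset.Icc 1 X, c k ≤ Real.exp ((cK : ℝ) * (Real.log (Real.log X) + 4)) := by
    set L := Real.log (Real.log X) + 4 with hL
    calc (∑ d₁ ∈ Finset.Icc 1 X, (tauFive d₁ : ℝ) * b d₁) * (∑ d₂ ∈ Finset.Icc 1 X, b d₂) *
          ∑ k ∈ Finset.Icc 1 X, c k
        ≤ (Real.exp (2 * 40401 * L)) ^ 5 * Real.exp (2 * 40401 * L) *
            Real.exp (2 * 80802 * L) := by
          have h5 : (∑ m ∈ Finset.Icc 1 X, b m) ^ 5 ≤ (Real.exp (2 * 40401 * L)) ^ 5 :=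
            pow_le_pow_left₀ hS0b hB 5
          have hA' := hA.trans h5
          have hE0 : 0 ≤ (Real.exp (2 * 40401 * L)) ^ 5 := pow_nonneg (Real.exp_pos _).le 5
          have hE1 : 0 ≤ (Real.exp (2 * 40401 * L)) ^ 5 * Real.exp (2 * 40401 * L) :=
            mul_nonneg hE0 (Real.exp_pos _).le
          exact mul_le_mul (mul_le_mul hA' hB hS0b hE0) hC hS0c hE1
      _ = Real.exp ((cK : ℝ) * L) := by
          rw [← Real.exp_nat_mul, ← Real.exp_add, ← Real.exp_add, hcK]
          congr 1
          push_cast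
          ring
  have hD3 : (3 : ℝ) ≤ D := by exact_mod_cast hD
  have hℓ1 : 1 ≤ Skeleton.ell D := by
    rw [Skeleton.ell]
    calc (1 : ℝ) ≤ Real.log 3 := by
          rw [Real.le_log_iff_exp_le (by norm_num)]
          linarith [Real.exp_one_lt_d9]
      _ ≤ Real.log D := Real.log_le_log (by norm_num) hD3
  have hlogX_le : Real.log X ≤ 2 * Skeleton.ell D ^ 9 := by
    have hℓ9 : 1 ≤ Skeleton.ell D ^ 9 := one_le_pow₀ hℓ1
    rcases le_total (N - 1) 2 with h | h
    · have : X = 2 := by rw [hX, max_eq_right h]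
      rw [this]
      push_cast
      linarith [Real.log_two_lt_d9]
    · have hXeq : X = N - 1 := by rw [hX, max_eq_left h]
      have hN1 : 1 ≤ N := by omega
      have hlogN : Real.log ((N - 1 : ℕ) : ℝ) ≤ Real.log N := by
        apply Real.log_le_log
        · exact_mod_cast (show 0 < N - 1 by omega)
        · exact_mod_cast Nat.sub_le N 1
      rw [hXeq]
      linarith [log_nsupp_le' D]
  have hsplit : Real.exp ((cK : ℝ) * (Real.log (Real.log X) + 4)) =
      Real.exp ((cK : ℝ) * 4) * Real.log X ^ cK := by
    rw [mul_add, Real.exp_add, Real.exp_nat_mul, Real.exp_log hlogX, mul_comm]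
  calc ∑ d₁ ∈ Finset.Ico 1 N, ∑ d₂ ∈ Finset.Ico 1 N, ∑ k ∈ Finset.Ico 1 N,
        ((tauFive d₁ : ℝ) * ∏ q ∈ (d₁ * d₂ * k).primeFactors, (1 + 200 / (q : ℝ) ^ (9 / 10 : ℝ)) ^ 2) /
          ((d₁ : ℝ) * d₂ * (Nat.totient k : ℝ))
      ≤ Real.exp ((cK : ℝ) * (Real.log (Real.log X) + 4)) := hstep.trans hE
    _ = Real.exp ((cK : ℝ) * 4) * Real.log X ^ cK := hsplit
    _ ≤ Real.exp ((cK : ℝ) * 4) * (2 * Skeleton.ell D ^ 9) ^ cK :=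
        mul_le_mul_of_nonneg_left (pow_le_pow_left₀ hlogX.le hlogX_le cK) (Real.exp_pos _).le
    _ = Real.exp ((cK : ℝ) * 4) * 2 ^ cK * Skeleton.ell D ^ (9 * cK) := by
        rw [mul_pow, ← pow_mul, mul_assoc]


/-! ## (7.20) AS PRINTED from `Z22:§7.u047` and the `G₀`-weighted contour bound -/

/-- **`Z22:(7.20)` from `Z22:§7.u047` and the weighted "standard estimates" bound (kernel-checked
assembly of the whole (7.19) → (7.20) leg under G-d24-1's repaired reading).** Given the contour
identity `Step7u047` and the contour bound with the weight
`G₀(d₁,d₂,k) = τ₅(d₁)∏_{q∣d₁d₂k}(1 + 200/q^{9/10})²`, the display (7.20) holds AS PRINTED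
(`Eq720 c′`, uniform `O(Pε₁)`): by `eq719_holds` (seat sz-d11), `step7u045_holds` (seat sz-d24),
`eq718_holds` (sz-d11), the weighted edges `step7u049_of_weighted`, `ded7u052_of_weighted`,
`eq720_of_weighted` (`Section7ResidueExtraction`) and `weightSum_tauFive_le` above.
[cite: Zhang2022LandauSiegel, §7 (7.20) p.41, tex L2104–L2138] -/
theorem eq720_of_step7u047_of_weighted_contour_bound (c' : ℝ) (h47 : Step7u047 c')
    (hbound : ∃ c : ℝ, 0 < c ∧ ∃ C : ℝ, Skeleton.ForAllLarge fun D _ χ =>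
      Skeleton.AssumptionA D χ → ∀ p ∈ Skeleton.primeWindow D, ∀ d₁ d₂ k l₂ : ℕ,
        0 < d₁ → 0 < d₂ → 0 < k → 0 < l₂ →
        ((d₂ * l₂ : ℕ) : ℝ) < Skeleton.bigP D / Skeleton.bigT D ^ 2 →
        ((d₁ * d₂ * k : ℕ) : ℝ) < Skeleton.bigP D / Skeleton.bigT D ^ 2 →
          ‖contour719 D (fun s =>
              (((l₂ : ℝ) / ((p : ℝ) * k) : ℝ) : ℂ) ^ (-s) *
                (Skeleton.kappaTilde c' D d₁ (d₂ * k) s * Skeleton.lam c' D (d₁ * d₂ * k) s *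
                  resFn c' D s))‖ ≤
            C * ((tauFive d₁ : ℝ) * ∏ q ∈ (d₁ * d₂ * k).primeFactors,
                (1 + 200 / (q : ℝ) ^ (9 / 10 : ℝ)) ^ 2) * ((p : ℝ) * k * eps1 c D / l₂)) :
    Eq720 c' := by
  have hG0 : ∀ D d₁ d₂ k : ℕ, 0 ≤ (fun (_D d₁ d₂ k : ℕ) => (tauFive d₁ : ℝ) *
      ∏ q ∈ (d₁ * d₂ * k).primeFactors, (1 + 200 / (q : ℝ) ^ (9 / 10 : ℝ)) ^ 2) D d₁ d₂ k := by
    intro D d₁ d₂ k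
    exact mul_nonneg (Nat.cast_nonneg _) (Finset.prod_nonneg fun q _ => sq_nonneg _)
  exact eq720_of_weighted c' _ hG0 weightSum_tauFive_le (eq718_holds c')
    (ded7u052_of_weighted c' _ hG0
      (step7u049_of_weighted c' _ (eq719_holds c') (step7u045_holds c') h47 hbound))

end Literature.NumberTheory.LFunctions.Zhang2022.Section7dStatements
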